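import Summits.CriticalPhenomena.PercolationContinuityZ3.Theorems.PercNearOneGluingNoHeavyLowerTailSahiCombFiveUpSet

/-!
# The five-up-set inequality: HYBRID sets, the hybrid Kleitman lemma, the proved face `A₁ = ⊤, B₀ = ∅`, and the
# open three-up-set face in hybrid form

Support file of the one-cut programme (crux `NoHeavyLowerTail`, stmt-CriticalPhenomena-4575; cell `prim-masterthm`, seat P5 gen 7;
report `P5-LORENTZIAN-TEST.md` §12).  Self-contained finite combinatorics on the Boolean lattice `Finset α` with the antipode `refl`
(`FiveUpSet.refl 𝒜 = {sᶜ | s ∈ 𝒜}`) of the gen-6 file `…SahiCombFiveUpSet`.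

* `FiveUpSet.hybrid B D := (B ∩ D) ∪ (refl B \ D)` — the HYBRID of a family `B` and its antipodal image along a cut `D`:
  `B` below the cut, `refl B` above it.  `hybrid B ∅ = refl B`, `hybrid B univ = B`.
* **`FiveUpSet.card_inter_hybrid_le`** (the hybrid Kleitman lemma, PROVED): for up-sets `U`, `B` and a down-set `D`,
  `#(U ∩ hybrid B D) ≤ #(U ∩ B)` — every hybrid injects upward into its up-set.  Proof: Kleitman's antipodal lemma
  (`card_inter_refl_le`) applied to the up-set `U \ D`.
* **`FiveUpSet.fiveUpSet_of_top_bot`**, **`fiveUpSet_of_bot_top`** (PROVED): the faces `A₁ = univ, B₀ = ∅` and `A₀ = ∅, B₁ = univ` of the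
  conjecture `FiveUpSetIneq`; each is ONE instance of the hybrid Kleitman lemma (report §12.4; found independently by prim-lf-1 gen 16, Addendum E).
* `FiveUpSet.ThreeUpSetIneq` — the face `B₀ = ∅` of `FiveUpSetIneq` (all `P`, `A₀ ⊆ A₁`, `B₁`), an obligation (`def … : Prop`, no axiom);
  `threeUpSet_of_fiveUpSet : FiveUpSetIneq → ThreeUpSetIneq`.
* `FiveUpSet.HybridKleitmanIneq` — the HYBRID KLEITMAN INEQUALITY `#(U ∩ refl X ∩ hybrid B D) ≤ #(U ∩ X ∩ B)` for all up-sets `U, X, B` and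
  down-sets `D` (report §12.4 (★3′)): for `D = ∅` and `D = univ` it is Kleitman's lemma (`hybridKleitman_bot`, `hybridKleitman_univ`, PROVED), and
  in general it INTERPOLATES the two; **`hybridKleitman_iff_threeUpSet : HybridKleitmanIneq ↔ ThreeUpSetIneq`** (PROVED) identifies it with the open face.
  Census (report §12.4, lattice-general: products of chains incl. `[4]×[3]` exhaustive 2.1e7, `2^4`, `[3]^3`): 0 violations.
HONEST LABEL: elementary lemmas + two more proved faces + an exact reformulation of the open face; `FiveUpSetIneq`, `ThreeUpSetIneq`,
`HybridKleitmanIneq`, `TRI ≥ 0`, (M⁺⁺-3) and `C_3` stay OPEN. [this work]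
-/

namespace Summit.CriticalPhenomena.PercolationContinuityZ3.Theorems

namespace FiveUpSet

open Finset

variable {α : Type*} [DecidableEq α] [Fintype α]

/-! ### Hybrid sets -/

/-- The HYBRID of a family `B` and its antipodal image along the cut `D`: `B` inside `D`, `refl B` outside `D`. [this work] -/
def hybrid (B D : Finset (Finset α)) : Finset (Finset α) := (B ∩ D) ∪ (refl B \ D)

/-- Membership in a hybrid. [this work] -/
theorem mem_hybrid {B D : Finset (Finset α)} {s : Finset α} :
    s ∈ hybrid B D ↔ (s ∈ B ∧ s ∈ D) ∨ (sᶜ ∈ B ∧ s ∉ D) := by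
  unfold hybrid
  simp only [mem_union, mem_inter, mem_sdiff, mem_refl]

/-- The hybrid along the empty cut is the antipodal image. [this work] -/
theorem hybrid_empty (B : Finset (Finset α)) : hybrid B ∅ = refl B := by
  ext s; simp [mem_hybrid, mem_refl]

/-- The hybrid along the full cut is the family itself. [this work] -/
theorem hybrid_univ (B : Finset (Finset α)) : hybrid B univ = B := by
  ext s; simp [mem_hybrid]

/-- Splitting a count over a hybrid along the cut: `#(S ∩ hybrid B D) = #(S ∩ D ∩ B) + #((S \ D) ∩ refl B)`. [this work] -/
theorem card_inter_hybrid (S B D : Finset (Finset α)) :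
    (S ∩ hybrid B D).card = (S ∩ D ∩ B).card + ((S \ D) ∩ refl B).card := by
  have h1 : S ∩ hybrid B D = (S ∩ D ∩ B) ∪ ((S \ D) ∩ refl B) := by
    ext s
    simp only [mem_inter, mem_hybrid, mem_union, mem_sdiff, mem_refl]
    tauto
  have h2 : Disjoint (S ∩ D ∩ B) ((S \ D) ∩ refl B) := by
    rw [disjoint_left]
    intro s hs hs'
    simp only [mem_inter, mem_sdiff] at hs hs'
    exact hs'.1.2 hs.1.2
  rw [h1, card_union_of_disjoint h2]

/-! ### The hybrid Kleitman lemma -/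

omit [Fintype α] in
/-- The complement of a down-set inside an up-set is an up-set: `U \ D` is an up-set for `U` up and `D` down. [this work] -/
theorem isUpperSet_sdiff {U D : Finset (Finset α)} (hU : IsUpperSet (U : Set (Finset α)))
    (hD : IsLowerSet (D : Set (Finset α))) : IsUpperSet ((U \ D : Finset (Finset α)) : Set (Finset α)) := by
  intro s t hst hs
  rw [mem_coe, mem_sdiff] at hs ⊢
  exact ⟨hU hst hs.1, fun ht => hs.2 (hD hst ht)⟩

/-- **Hybrid Kleitman lemma.**  For up-sets `U`, `B` and a down-set `D`: `#(U ∩ hybrid B D) ≤ #(U ∩ B)` — the hybrid of `B` along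
any cut injects upward into `B` (Hall form).  Proof: split along the cut; inside `D` the hybrid IS `B`; outside `D` apply Kleitman's
antipodal lemma `card_inter_refl_le` to the up-set `U \ D`. [this work] -/
theorem card_inter_hybrid_le (U B D : Finset (Finset α)) (hU : IsUpperSet (U : Set (Finset α)))
    (hB : IsUpperSet (B : Set (Finset α))) (hD : IsLowerSet (D : Set (Finset α))) :
    (U ∩ hybrid B D).card ≤ (U ∩ B).card := by
  rw [card_inter_hybrid]
  have hK : ((U \ D) ∩ refl B).card ≤ ((U \ D) ∩ B).card := card_inter_refl_le (isUpperSet_sdiff hU hD) hB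
  have hsplit : (U ∩ D ∩ B).card + ((U \ D) ∩ B).card = (U ∩ B).card := by
    have e : U ∩ B = (U ∩ D ∩ B) ∪ ((U \ D) ∩ B) := by
      ext s; simp only [mem_inter, mem_union, mem_sdiff]; tauto
    have d : Disjoint (U ∩ D ∩ B) ((U \ D) ∩ B) := by
      rw [disjoint_left]
      intro s hs hs'
      simp only [mem_inter, mem_sdiff] at hs hs'
      exact hs'.1.2 hs.1.2
    rw [e, card_union_of_disjoint d]
  omega

/-! ### Two more proved faces of `FiveUpSetIneq` -/

/-- The face `A₁ = univ`, `B₀ = ∅` of the five-up-set inequality: for up-sets `P, A, B`,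
`#(P ∩ univ ∩ refl ∅) + #(P ∩ refl A ∩ B) + #(P ∩ refl (univ \ A) ∩ refl (B \ ∅)) ≤ #(P ∩ univ ∩ B) + #(P ∩ A ∩ ∅)`, i.e.
`#(P ∩ refl A ∩ B) + #(P ∩ refl (Aᶜ) ∩ refl B) ≤ #(P ∩ B)`.  It is the hybrid Kleitman lemma for the cut `D = refl A`
(`P ∩ hybrid B (refl A)` is exactly the union of the two families on the left). [this work] -/
theorem fiveUpSet_of_top_bot (P A B : Finset (Finset α)) (hP : IsUpperSet (P : Set (Finset α)))
    (hA : IsUpperSet (A : Set (Finset α))) (hB : IsUpperSet (B : Set (Finset α))) :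
    (P ∩ univ ∩ refl (∅ : Finset (Finset α))).card + (P ∩ refl A ∩ B).card + (P ∩ refl (univ \ A) ∩ refl (B \ ∅)).card
      ≤ (P ∩ univ ∩ B).card + (P ∩ A ∩ ∅).card := by
  have h0 : (P ∩ univ ∩ refl (∅ : Finset (Finset α))).card = 0 := by simp [refl]
  have h00 : (P ∩ A ∩ ∅).card = 0 := by simp
  have hmain := card_inter_hybrid_le P B (refl A) hP hB (isLowerSet_refl hA)
  rw [card_inter_hybrid] at hmain
  have e2 : (P ∩ refl (univ \ A) ∩ refl (B \ ∅)).card = ((P \ refl A) ∩ refl B).card := by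
    congr 1
    ext s
    simp only [mem_inter, mem_sdiff, mem_refl, mem_univ, true_and, Finset.notMem_empty, not_false_eq_true, and_true]
  have e3 : (P ∩ univ ∩ B).card = (P ∩ B).card := by rw [inter_univ]
  rw [h0, h00, e2, e3, zero_add, add_zero]
  exact hmain

/-- The mirror face `A₀ = ∅`, `B₁ = univ`: `#(P ∩ A ∩ refl B) + #(P ∩ refl ∅ ∩ univ) + #(P ∩ refl (A \ ∅) ∩ refl (univ \ B)) ≤ #(P ∩ A ∩ univ) + #(P ∩ ∅ ∩ B)`,
i.e. `#(P ∩ A ∩ refl B) + #(P ∩ refl A ∩ refl (Bᶜ)) ≤ #(P ∩ A)` — the hybrid Kleitman lemma for `hybrid A (refl B)`. [this work] -/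
theorem fiveUpSet_of_bot_top (P A B : Finset (Finset α)) (hP : IsUpperSet (P : Set (Finset α)))
    (hA : IsUpperSet (A : Set (Finset α))) (hB : IsUpperSet (B : Set (Finset α))) :
    (P ∩ A ∩ refl B).card + (P ∩ refl (∅ : Finset (Finset α)) ∩ univ).card + (P ∩ refl (A \ ∅) ∩ refl (univ \ B)).card
      ≤ (P ∩ A ∩ univ).card + (P ∩ ∅ ∩ B).card := by
  have h0 : (P ∩ refl (∅ : Finset (Finset α)) ∩ univ).card = 0 := by simp [refl]
  have h00 : (P ∩ ∅ ∩ B).card = 0 := by simp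
  have hmain := card_inter_hybrid_le P A (refl B) hP hA (isLowerSet_refl hB)
  rw [card_inter_hybrid] at hmain
  have e1 : (P ∩ A ∩ refl B).card = (P ∩ refl B ∩ A).card := by
    rw [inter_assoc, inter_comm A, ← inter_assoc]
  have e2 : (P ∩ refl (A \ ∅) ∩ refl (univ \ B)).card = ((P \ refl B) ∩ refl A).card := by
    congr 1
    ext s
    simp only [mem_inter, mem_sdiff, mem_refl, mem_univ, true_and, Finset.notMem_empty, not_false_eq_true, and_true]
    tauto
  have e3 : (P ∩ A ∩ univ).card = (P ∩ A).card := by rw [inter_univ]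
  rw [h0, h00, e1, e2, e3, add_zero, add_zero]
  exact hmain

/-! ### The open three-up-set face and its hybrid form -/

/-- **The three-up-set inequality** = the face `B₀ = ∅` of `FiveUpSetIneq` (an obligation of our theories, never a fact; OPEN):
for up-sets `P`, `A₀ ⊆ A₁`, `B` of a finite cube, `#(P ∩ refl A₀ ∩ B) + #(P ∩ refl (A₁ \ A₀) ∩ refl B) ≤ #(P ∩ A₁ ∩ B)`.
(prim-lf-1 gen 16 calls its rank strengthening `L0`.)  Census: report §11.3/§12.4; exhaustive `n ≤ 5` via `FiveUpSetIneq`. [this work] -/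
@[conjecture] def ThreeUpSetIneq : Prop :=
  ∀ (α : Type) [DecidableEq α] [Fintype α] (P A₀ A₁ B : Finset (Finset α)),
    IsUpperSet (P : Set (Finset α)) → IsUpperSet (A₀ : Set (Finset α)) → IsUpperSet (A₁ : Set (Finset α)) →
    IsUpperSet (B : Set (Finset α)) → A₀ ⊆ A₁ →
      (P ∩ refl A₀ ∩ B).card + (P ∩ refl (A₁ \ A₀) ∩ refl B).card ≤ (P ∩ A₁ ∩ B).card

/-- **The hybrid Kleitman inequality** (report §12.4 (★3′); an obligation, OPEN): for up-sets `U, X, B` and a DOWN-set `D` of a finite cube,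
`#(U ∩ refl X ∩ hybrid B D) ≤ #(U ∩ X ∩ B)`.  For `D = ∅` (`hybrid B ∅ = refl B`) and `D = univ` (`hybrid B univ = B`) it is Kleitman's
antipodal lemma; in general it interpolates the two along the cut `D`.  Equivalent to `ThreeUpSetIneq` (`hybridKleitman_iff_threeUpSet`). [this work] -/
@[conjecture] def HybridKleitmanIneq : Prop :=
  ∀ (α : Type) [DecidableEq α] [Fintype α] (U X B D : Finset (Finset α)),
    IsUpperSet (U : Set (Finset α)) → IsUpperSet (X : Set (Finset α)) → IsUpperSet (B : Set (Finset α)) →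
    IsLowerSet (D : Set (Finset α)) →
      (U ∩ refl X ∩ hybrid B D).card ≤ (U ∩ X ∩ B).card

/-- The cut `D = ∅` of the hybrid Kleitman inequality is Kleitman's lemma for `X ∩ B` (PROVED). [this work] -/
theorem hybridKleitman_bot (U X B : Finset (Finset α)) (hU : IsUpperSet (U : Set (Finset α)))
    (hX : IsUpperSet (X : Set (Finset α))) (hB : IsUpperSet (B : Set (Finset α))) :
    (U ∩ refl X ∩ hybrid B ∅).card ≤ (U ∩ X ∩ B).card := by
  rw [hybrid_empty, inter_assoc, ← refl_inter, inter_assoc]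
  have hXB : IsUpperSet ((X ∩ B : Finset (Finset α)) : Set (Finset α)) := by rw [coe_inter]; exact hX.inter hB
  exact card_inter_refl_le hU hXB

/-- The cut `D = univ` of the hybrid Kleitman inequality is Kleitman's lemma for `X` inside `U ∩ B` (PROVED). [this work] -/
theorem hybridKleitman_univ (U X B : Finset (Finset α)) (hU : IsUpperSet (U : Set (Finset α)))
    (hX : IsUpperSet (X : Set (Finset α))) (hB : IsUpperSet (B : Set (Finset α))) :
    (U ∩ refl X ∩ hybrid B univ).card ≤ (U ∩ X ∩ B).card := by
  rw [hybrid_univ]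
  have hUB : IsUpperSet ((U ∩ B : Finset (Finset α)) : Set (Finset α)) := by rw [coe_inter]; exact hU.inter hB
  have h := card_inter_refl_le hUB hX
  have e1 : U ∩ refl X ∩ B = U ∩ B ∩ refl X := by rw [inter_assoc, inter_comm (refl X), ← inter_assoc]
  have e2 : U ∩ X ∩ B = U ∩ B ∩ X := by rw [inter_assoc, inter_comm X, ← inter_assoc]
  rw [e1, e2]; exact h

/-- `FiveUpSetIneq` implies its face `B₀ = ∅`. [this work] -/
theorem threeUpSet_of_fiveUpSet (h : FiveUpSetIneq) : ThreeUpSetIneq := by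
  intro α _ _ P A₀ A₁ B hP hA₀ hA₁ hB hA
  have h5 := h α P A₀ A₁ ∅ B hP hA₀ hA₁ (by simp [IsUpperSet]) hB hA (empty_subset B)
  have e0 : (P ∩ A₁ ∩ refl (∅ : Finset (Finset α))).card = 0 := by simp [refl]
  have e1 : (P ∩ A₀ ∩ ∅).card = 0 := by simp
  rw [e0, e1, sdiff_empty, zero_add, add_zero] at h5
  exact h5

/-- **The hybrid Kleitman inequality is exactly the three-up-set face** (exact reformulation, report §12.4):
`HybridKleitmanIneq ↔ ThreeUpSetIneq`.  (→): take `D := refl A₀`, a down-set with `U ∩ refl A₁ ∩ hybrid B (refl A₀) =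
(P ∩ refl A₀ ∩ B) ⊔ (P ∩ refl(A₁ \ A₀) ∩ refl B)`.  (←): given `U, X, B, D` put `A₁ := X`, `A₀ := X ∩ refl D` (an up-set, `⊆ X`);
then `refl A₀ = refl X ∩ D` and `refl (A₁ \ A₀) = refl X \ D`. [this work] -/
theorem hybridKleitman_iff_threeUpSet : HybridKleitmanIneq ↔ ThreeUpSetIneq := by
  constructor
  · intro h α _ _ P A₀ A₁ B hP hA₀ hA₁ hB hA
    have hh := h α P A₁ B (refl A₀) hP hA₁ hB (isLowerSet_refl hA₀)
    rw [card_inter_hybrid] at hh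
    -- identify the two pieces
    have e1 : P ∩ refl A₁ ∩ refl A₀ ∩ B = P ∩ refl A₀ ∩ B := by
      ext s
      simp only [mem_inter, mem_refl]
      constructor
      · rintro ⟨⟨⟨hs, -⟩, h0⟩, hb⟩; exact ⟨⟨hs, h0⟩, hb⟩
      · rintro ⟨⟨hs, h0⟩, hb⟩; exact ⟨⟨⟨hs, hA h0⟩, h0⟩, hb⟩
    have e2 : ((P ∩ refl A₁) \ refl A₀) ∩ refl B = P ∩ refl (A₁ \ A₀) ∩ refl B := by
      ext s
      simp only [mem_inter, mem_sdiff, mem_refl]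
      tauto
    rw [e1, e2] at hh
    exact hh
  · intro h α _ _ U X B D hU hX hB hD
    -- A₀ := X ∩ refl D
    have hDup : IsUpperSet ((refl D : Finset (Finset α)) : Set (Finset α)) := by
      intro s t hst hs
      rw [mem_coe, mem_refl] at hs ⊢
      exact hD (compl_subset_compl.2 hst) hs
    have hA₀ : IsUpperSet ((X ∩ refl D : Finset (Finset α)) : Set (Finset α)) := by
      rw [coe_inter]; exact hX.inter hDup
    have hh := h α U (X ∩ refl D) X B hU hA₀ hX hB inter_subset_left
    rw [card_inter_hybrid]
    have e1 : U ∩ refl X ∩ D ∩ B = U ∩ refl (X ∩ refl D) ∩ B := by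
      ext s
      simp only [mem_inter, mem_refl, compl_compl]
      tauto
    have e2 : ((U ∩ refl X) \ D) ∩ refl B = U ∩ refl (X \ (X ∩ refl D)) ∩ refl B := by
      ext s
      simp only [mem_inter, mem_sdiff, mem_refl, compl_compl]
      tauto
    rw [e1, e2]
    exact hh

end FiveUpSet

end Summit.CriticalPhenomena.PercolationContinuityZ3.Theorems
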